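import Summits.HodgeConjecture.Ring2.FivefoldFactHolds
import Summits.HodgeConjecture.Ring2.NonSimpleFourfoldsCodimTwo
import Literature.AlgebraicGeometry.HodgeTheory.UnitaryTwoTwoFourfoldHodgeClasses
import HarnessLib

/-!
# Ring 2 (cell topic `Summits/HodgeConjecture/Ring2/`; seat `lit`, gen 69, R46-A′): TYPE IV(1,1) LEAVES THE ROW-FOUR RESIDUAL — the fourfold fact and `HCUpToDim 5` modulo Markman localise to the simple non-CM fourfolds whose endomorphism algebra is NOT an imaginary quadratic field

HONEST FRAMING (cell `pub-hodge-ring2`, verbatim): research route conditional on HC_CM; not a corollary;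
Q11.4-sentence-2 already refuted in dim ≥ 3. `HC_CM` does NOT occur in this file. Markman's theorem
(`Markman2025_weilClasses_algebraic_abelianFourfold`) is a HYPOTHESIS of the axis theorem of §2, never asserted.
Theorems only — no definition, no named fact, no `sorry`.

THE PRINT. B. Moonen, Yu. Zarhin, *Hodge classes and Tate classes on simple abelian fourfolds*, Duke Math. J. **77**
(1995): for a simple abelian fourfold `X` of type IV(1,1) (`End⁰(X) = K` imaginary quadratic) either `K` acts with
multiplicities `(3,1)` and `B•(X) = D•(X)`, or with multiplicities `(2,2)` and the Hodge ring is generated by divisor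
classes and the Weil classes `W_K`; Math. Ann. **315** (1999) §2 (2.5) (2): «For `g = 4` we find cases where in addition
to divisor classes we also need Weil classes to generate the Hodge ring. This happens if `End⁰(X)` contains an imaginary
quadratic field `k` which acts on the tangent space with multiplicities `(2,2)`»; §2 (2.3): «An action with
multiplicities `(3,0)` is excluded; see [Shimura], Proposition 14».

THIS FILE. Input: the Literature lane's UNCONDITIONAL `UnitaryTwoTwoFourfoldHodgeClasses` (lit g68–g69, R45–R46:
the `(2,2)` Θ-subalgebra theorem `Lie Hg ⊗ ℂ ⊇ 𝔰𝔲_K(V,ψ)_ℂ`, the `AVSlots` invariance theorem at `(2,2)`, the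
elementary `𝔰𝔩₄` invariant theory of `MixedTensorLieInvariantsSL` §4–§5, and the packaging
`AbelianVariety.isCodimTwoDivisorWeilGenerated_of_isSimple_of_finrank_end_eq_two`: a SIMPLE fourfold with
`φ ≫ φ = -d`, `finrank_ℚ End⁰ = 2` satisfies `B² ⊆ D² + Σ_k W_k` — Ribet `(3,1)` or Weil `(2,2)`, `(4,0)` excluded).
* §1 **`moonenZarhin1999_codimTwoHodgeClasses_abelianFourfold_iff_residual_noImaginaryQuadratic`** — the FOURFOLD FACT
  (Moonen–Zarhin Thm. 0.1 in codimension two, the tree's named fact `MoonenZarhin1999_codimTwoHodgeClasses_abelianFourfold`)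
  is EQUIVALENT to `B² ⊆ D² + Σ W_K` on the simple non-CM fourfolds with NO imaginary quadratic endomorphism algebra
  (`¬ ∃ φ d, 0 < d ∧ φ ≫ φ = -d ∧ finrank_ℚ End⁰ = 2`), NOT of minimal quaternion type, NOT of maximal
  real-multiplication type, NOT of quartic CM type `{(1,1),(2,0)}` — what is left of Moonen–Zarhin 1995: types I(1),
  I(2), II and III over `ℚ`, IV(2,1) `⊇ k` of signature `(2,2)`, IV with `d = 2`.
* §2 **`hcUpToDim_five_iff_rowFour_noImaginaryQuadratic_of_markman`** — MODULO MARKMAN ALONE: `HCUpToDim 5` is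
  EQUIVALENT to the Hodge conjecture on that same residual class (the previous axis theorem
  `FivefoldFactHolds.hcUpToDim_five_iff_rowFour_refined_of_markman` minus the whole type IV(1,1));
  `hodgeConjectureFor_of_dim_eq_four_of_isSimple_of_imaginaryQuadratic_of_markman` (the cell, pointwise);
  `rowFourNoImaginaryQuadratic_hcOnClass_of_hodgeConjecture` (on path).

WHAT IS NOT CLAIMED: the residual is NOT closed; Markman is never asserted; `B•(Xⁿ)` for powers of `(2,2)`-fourfolds
(needs the tensor FFT for `SL₄`) is not touched; no `HC_CM`.

## References
* [MoonenZarhin1995Duke] B. Moonen, Yu. Zarhin, Duke Math. J. 77 (1995), Thm. 2.4 and the type IV(1,1) row.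
* [MoonenZarhin1999LowDim] B. Moonen, Yu. Zarhin, Math. Ann. 315 (1999), Thm. 0.1, §2 (2.3), (2.5) (2).
* [Ribet1983] K. A. Ribet, Amer. J. Math. 105 (1983), Thm. 3.
* [Shimura1963AnalyticFamilies] G. Shimura, Ann. of Math. 78 (1963), §4 Prop. 14.
* [vanGeemen1994HodgeAV] B. van Geemen, LNM 1594 (1994), Lemma 5.4, Thm. 6.12.
* [Deligne2000] P. Deligne, *The Hodge conjecture* (Clay problem description, 2000), §1.
* [claim: Markman2025SurveySecant, status: under-review] E. Markman, arXiv:2509.23403, Thm. 1.2.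
-/

noncomputable section

open CategoryTheory CategoryTheory.Limits

namespace Summit.HodgeConjecture.Ring2.RowFourTypeIVOneOne

open Literature.AlgebraicGeometry.Motives (AbelianVariety)
open Literature.AlgebraicGeometry.Motives.AbelianVariety
open Literature.AlgebraicGeometry.HodgeTheory
open Literature.AlgebraicGeometry.ComplexMultiplication
open Literature.AlgebraicGeometry.Milne1999
open NumberField
open Literature.NumberTheory.Automorphic (IsQuaternionAlgebra)
open Summit.HodgeConjecture.HodgeConjecture.Ring2.ClassTargets
open Summit.HodgeConjecture.Ring2.FivefoldFactHolds
open Summit.HodgeConjecture.Ring2.NonSimpleFourfoldsCodimTwo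

variable {X : AbelianVariety ℂ}

/-! ### §1 The fourfold fact localised past type IV(1,1) -/

/-- **THE RESIDUAL OF THE FOURFOLD FACT, FOURTH REFINEMENT — TYPE IV(1,1) REMOVED.** The named fact
`MoonenZarhin1999_codimTwoHodgeClasses_abelianFourfold` (Thm. 0.1 in codimension two: every abelian fourfold has
`B² ⊆ D² + Σ_k W_k`) is EQUIVALENT to its instances at the simple non-CM fourfolds whose endomorphism algebra is NOT an
imaginary quadratic field (`¬ ∃ φ d, 0 < d ∧ φ ≫ φ = -d ∧ finrank_ℚ End⁰ = 2`) and which are NOT of minimal quaternion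
type, NOT of maximal real-multiplication type, NOT of quartic CM type `{(1,1),(2,0)}`. The previous residual
(`NonSimpleFourfoldsCodimTwo.moonenZarhin1999_codimTwoHodgeClasses_abelianFourfold_iff_residual''`) excluded only the
Ribet sub-row `(3,1)` of type IV(1,1); the `(2,2)` sub-row is now the Literature lane's UNCONDITIONAL
`AbelianVariety.isCodimTwoDivisorWeilGenerated_of_isSimple_of_finrank_end_eq_two` (Moonen–Zarhin 1995: `B² ⊆ D² + W_K`).
[cite: MoonenZarhin1995Duke, Thm. 2.4 and the type IV(1,1) row] [cite: MoonenZarhin1999LowDim, Thm. 0.1, §2 (2.3) and (2.5) (2)]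
[cite: Ribet1983, Thm. 3] [cite: Shimura1963AnalyticFamilies, §4 Prop. 14] -/
theorem moonenZarhin1999_codimTwoHodgeClasses_abelianFourfold_iff_residual_noImaginaryQuadratic :
    MoonenZarhin1999_codimTwoHodgeClasses_abelianFourfold ↔
      ∀ A : AbelianVariety ℂ, A.dim = 4 → A.IsSimple → ¬ IsOfCMType A →
        (¬ ∃ (φ : A ⟶ A) (d : ℕ), 0 < d ∧ φ ≫ φ = -(d • 𝟙 A) ∧ Module.finrank ℚ A.endAlgebra = 2) →
        (¬ ∃ (K : Type) (_ : Field K) (_ : NumberField K) (_ : IsTotallyReal K) (_ : Algebra K A.endAlgebra)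
          (_ : IsScalarTower ℚ K A.endAlgebra) (_ : IsQuaternionAlgebra K A.endAlgebra),
            A.dim = 2 * Module.finrank ℚ K) →
        (¬ ∃ hF : IsField A.endAlgebra, NumberField.IsTotallyReal (EndField A hF) ∧
          Module.finrank ℚ A.endAlgebra = A.dim) →
        (¬ ∃ (φ : A ⟶ A) (μ₁ μ₂ : ℂ), Module.finrank ℚ A.endAlgebra = 4 ∧ starRingEnd ℂ μ₁ ≠ μ₁ ∧
          starRingEnd ℂ μ₂ ≠ μ₂ ∧ μ₂ ≠ μ₁ ∧ μ₂ ≠ starRingEnd ℂ μ₁ ∧ eigenMultiplicity A φ μ₁ = 1 ∧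
          eigenMultiplicity A φ (starRingEnd ℂ μ₁) = 1 ∧ eigenMultiplicity A φ μ₂ = 2) →
        IsCodimTwoDivisorWeilGenerated A := by
  rw [moonenZarhin1999_codimTwoHodgeClasses_abelianFourfold_iff_residual'']
  refine ⟨fun h A hA hs hcm hK hQ hT hC => h A hA hs hcm (fun ⟨φ, d, hd, hφ, hE2, _⟩ => hK ⟨φ, d, hd, hφ, hE2⟩)
    hQ hT hC, fun h A hA hs hcm _ hQ hT hC => ?_⟩
  by_cases hK : ∃ (φ : A ⟶ A) (d : ℕ), 0 < d ∧ φ ≫ φ = -(d • 𝟙 A) ∧ Module.finrank ℚ A.endAlgebra = 2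
  · obtain ⟨φ, d, hd, hφ, hE2⟩ := hK
    exact AbelianVariety.isCodimTwoDivisorWeilGenerated_of_isSimple_of_finrank_end_eq_two A hs φ hd hφ hE2 hA
  exact h A hA hs hcm hK hQ hT hC

/-! ### §2 The HC axis modulo MARKMAN ALONE: row four without type IV(1,1) -/

/-- **The Hodge conjecture for every SIMPLE complex abelian fourfold whose endomorphism algebra is an imaginary quadratic
field, GRANTED Markman's theorem** (hypothesis `hMark`; the Literature lane's
`hodgeConjectureFor_of_isSimple_fourfold_of_finrank_end_eq_two_of_markman`: Ribet `(3,1)` unconditionally, `(2,2)` via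
`B² ⊆ D² + W_K` and the Weil classes). [cite: MoonenZarhin1995Duke, Thm. 2.4 and the type IV(1,1) row] [cite: Ribet1983, Thm. 3]
[claim: Markman2025SurveySecant, status: under-review] -/
theorem hodgeConjectureFor_of_dim_eq_four_of_isSimple_of_imaginaryQuadratic_of_markman
    (hMark : Markman2025_weilClasses_algebraic_abelianFourfold) (hX4 : X.dim = 4) (hs : X.IsSimple) (φ : X ⟶ X)
    {d : ℕ} (hd : 0 < d) (hφ : φ ≫ φ = -(d • 𝟙 X)) (hE2 : Module.finrank ℚ X.endAlgebra = 2) :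
    HodgeConjectureFor X.dim X.X :=
  hodgeConjectureFor_of_isSimple_fourfold_of_finrank_end_eq_two_of_markman hMark X hs φ hd hφ hE2 hX4

/-- **`HCUpToDim 5` MODULO MARKMAN ALONE, TYPE IV(1,1) REMOVED**: granted `Markman2025_weilClasses_algebraic_abelianFourfold`
(hypothesis; no Ribet, no Tankeev–Ribet, no `HC_CM`), the Hodge conjecture for all complex abelian varieties of
dimension `≤ 5` is EQUIVALENT to the Hodge conjecture on the simple non-CM FOURFOLDS whose endomorphism algebra is NOT an
imaginary quadratic field and which are of none of the three types minimal quaternion, maximal real multiplication,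
quartic CM `{(1,1),(2,0)}` — what is left of Moonen–Zarhin 1995: types I(1) (`End⁰ = ℚ`: `Sp₈` versus the `ℚ`-forms of
`SL₂³`), I(2), II and III over `ℚ`, IV(2,1) `⊇ k` of signature `(2,2)`, IV with `d = 2`.
[cite: MoonenZarhin1999LowDim, Thm. 0.1, Thm. 0.2 and §2 (2.5)] [cite: MoonenZarhin1995Duke, Thm. 2.4]
[cite: Ribet1983, Thm. 3] [claim: Markman2025SurveySecant, status: under-review] -/
theorem hcUpToDim_five_iff_rowFour_noImaginaryQuadratic_of_markman
    (hMark : Markman2025_weilClasses_algebraic_abelianFourfold) :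
    HCUpToDim 5 ↔ HCOnClass fun A => A.dim = 4 ∧ A.IsSimple ∧ ¬ IsOfCMType A ∧
      (¬ ∃ (φ : A ⟶ A) (d : ℕ), 0 < d ∧ φ ≫ φ = -(d • 𝟙 A) ∧ Module.finrank ℚ A.endAlgebra = 2) ∧
      (¬ ∃ (K : Type) (_ : Field K) (_ : NumberField K) (_ : IsTotallyReal K) (_ : Algebra K A.endAlgebra)
        (_ : IsScalarTower ℚ K A.endAlgebra) (_ : IsQuaternionAlgebra K A.endAlgebra), A.dim = 2 * Module.finrank ℚ K) ∧
      (¬ ∃ hF : IsField A.endAlgebra, IsTotallyReal (EndField A hF) ∧ Module.finrank ℚ A.endAlgebra = A.dim) ∧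
      (¬ ∃ (φ : A ⟶ A) (μ₁ μ₂ : ℂ), Module.finrank ℚ A.endAlgebra = 4 ∧ starRingEnd ℂ μ₁ ≠ μ₁ ∧
        starRingEnd ℂ μ₂ ≠ μ₂ ∧ μ₂ ≠ μ₁ ∧ μ₂ ≠ starRingEnd ℂ μ₁ ∧ eigenMultiplicity A φ μ₁ = 1 ∧
        eigenMultiplicity A φ (starRingEnd ℂ μ₁) = 1 ∧ eigenMultiplicity A φ μ₂ = 2) := by
  rw [hcUpToDim_five_iff_rowFour_refined_of_markman hMark]
  refine ⟨fun h => hcOnClass_mono (fun A hA => ⟨hA.1, hA.2.1, hA.2.2.1,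
      fun ⟨φ, d, hd, hφ, hE2, _⟩ => hA.2.2.2.1 ⟨φ, d, hd, hφ, hE2⟩, hA.2.2.2.2⟩) h,
    fun h A hA => ?_⟩
  obtain ⟨hA4, hs, hcm, _, hQ, hT, hC⟩ := hA
  by_cases hK : ∃ (φ : A ⟶ A) (d : ℕ), 0 < d ∧ φ ≫ φ = -(d • 𝟙 A) ∧ Module.finrank ℚ A.endAlgebra = 2
  · obtain ⟨φ, d, hd, hφ, hE2⟩ := hK
    exact hodgeConjectureFor_of_dim_eq_four_of_isSimple_of_imaginaryQuadratic_of_markman hMark hA4 hs φ hd hφ hE2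
  exact h A ⟨hA4, hs, hcm, hK, hQ, hT, hC⟩

/-- **`HCAtDim 4` MODULO MARKMAN, TYPE IV(1,1) REMOVED** (the row-`4` cell alone: `HC` for all complex abelian FOURFOLDS is
equivalent, granted Markman, to `HC` on the same residual class). [cite: MoonenZarhin1995Duke, Thm. 2.4]
[cite: MoonenZarhin1999LowDim, Thm. 0.1] [claim: Markman2025SurveySecant, status: under-review] -/
theorem hcAtDim_four_iff_rowFour_noImaginaryQuadratic_of_markman
    (hMark : Markman2025_weilClasses_algebraic_abelianFourfold) :
    HCAtDim 4 ↔ HCOnClass fun A => A.dim = 4 ∧ A.IsSimple ∧ ¬ IsOfCMType A ∧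
      (¬ ∃ (φ : A ⟶ A) (d : ℕ), 0 < d ∧ φ ≫ φ = -(d • 𝟙 A) ∧ Module.finrank ℚ A.endAlgebra = 2) ∧
      (¬ ∃ (K : Type) (_ : Field K) (_ : NumberField K) (_ : IsTotallyReal K) (_ : Algebra K A.endAlgebra)
        (_ : IsScalarTower ℚ K A.endAlgebra) (_ : IsQuaternionAlgebra K A.endAlgebra), A.dim = 2 * Module.finrank ℚ K) ∧
      (¬ ∃ hF : IsField A.endAlgebra, IsTotallyReal (EndField A hF) ∧ Module.finrank ℚ A.endAlgebra = A.dim) ∧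
      (¬ ∃ (φ : A ⟶ A) (μ₁ μ₂ : ℂ), Module.finrank ℚ A.endAlgebra = 4 ∧ starRingEnd ℂ μ₁ ≠ μ₁ ∧
        starRingEnd ℂ μ₂ ≠ μ₂ ∧ μ₂ ≠ μ₁ ∧ μ₂ ≠ starRingEnd ℂ μ₁ ∧ eigenMultiplicity A φ μ₁ = 1 ∧
        eigenMultiplicity A φ (starRingEnd ℂ μ₁) = 1 ∧ eigenMultiplicity A φ μ₂ = 2) := by
  constructor
  · exact fun h => hcOnClass_mono (fun A hA => hA.1) h
  · intro h
    have h5 : HCUpToDim 5 := (hcUpToDim_five_iff_rowFour_noImaginaryQuadratic_of_markman hMark).2 h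
    exact hcOnClass_mono (fun A (hA : A.dim = 4) => show A.dim ≤ 5 by omega) h5

/-- **On path**: the residual class is a case of the summit. [cite: Deligne2000, §1] -/
theorem rowFourNoImaginaryQuadratic_hcOnClass_of_hodgeConjecture (h : _root_.HodgeConjecture) :
    HCOnClass fun A => A.dim = 4 ∧ A.IsSimple ∧ ¬ IsOfCMType A ∧
      (¬ ∃ (φ : A ⟶ A) (d : ℕ), 0 < d ∧ φ ≫ φ = -(d • 𝟙 A) ∧ Module.finrank ℚ A.endAlgebra = 2) ∧
      (¬ ∃ (K : Type) (_ : Field K) (_ : NumberField K) (_ : IsTotallyReal K) (_ : Algebra K A.endAlgebra)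
        (_ : IsScalarTower ℚ K A.endAlgebra) (_ : IsQuaternionAlgebra K A.endAlgebra), A.dim = 2 * Module.finrank ℚ K) ∧
      (¬ ∃ hF : IsField A.endAlgebra, IsTotallyReal (EndField A hF) ∧ Module.finrank ℚ A.endAlgebra = A.dim) ∧
      (¬ ∃ (φ : A ⟶ A) (μ₁ μ₂ : ℂ), Module.finrank ℚ A.endAlgebra = 4 ∧ starRingEnd ℂ μ₁ ≠ μ₁ ∧
        starRingEnd ℂ μ₂ ≠ μ₂ ∧ μ₂ ≠ μ₁ ∧ μ₂ ≠ starRingEnd ℂ μ₁ ∧ eigenMultiplicity A φ μ₁ = 1 ∧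
        eigenMultiplicity A φ (starRingEnd ℂ μ₁) = 1 ∧ eigenMultiplicity A φ μ₂ = 2) :=
  hcOnClass_of_hodgeConjecture _ h

/-- **The simple type IV(1,1) fourfolds form a CLOSED class target modulo Markman** (`HCOnClass`, granted `hMark`).
[cite: MoonenZarhin1995Duke, Thm. 2.4 and the type IV(1,1) row] [claim: Markman2025SurveySecant, status: under-review] -/
theorem simpleTypeIVOneOneFourfolds_hcOnClass_of_markman (hMark : Markman2025_weilClasses_algebraic_abelianFourfold) :
    HCOnClass fun A => A.dim = 4 ∧ A.IsSimple ∧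
      ∃ (φ : A ⟶ A) (d : ℕ), 0 < d ∧ φ ≫ φ = -(d • 𝟙 A) ∧ Module.finrank ℚ A.endAlgebra = 2 := by
  rintro A ⟨hA4, hs, φ, d, hd, hφ, hE2⟩
  exact hodgeConjectureFor_of_dim_eq_four_of_isSimple_of_imaginaryQuadratic_of_markman hMark hA4 hs φ hd hφ hE2

/-- **On path**: the type IV(1,1) class is a case of the summit. [cite: Deligne2000, §1] -/
theorem simpleTypeIVOneOneFourfolds_hcOnClass_of_hodgeConjecture (h : _root_.HodgeConjecture) :
    HCOnClass fun A => A.dim = 4 ∧ A.IsSimple ∧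
      ∃ (φ : A ⟶ A) (d : ℕ), 0 < d ∧ φ ≫ φ = -(d • 𝟙 A) ∧ Module.finrank ℚ A.endAlgebra = 2 :=
  hcOnClass_of_hodgeConjecture _ h

end Summit.HodgeConjecture.Ring2.RowFourTypeIVOneOne

end
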